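import Summits.BirchSwinnertonDyer.BirchSwinnertonDyer.Theorems.AdditiveBranchIMCTwistRootNumberTwistedKroneckerAnyTwo
import HarnessLib

/-!
# The E3′ root-number engine, POSITIVE-PARAMETER form, ANY TWIST-TYPE REDUCTION AT `2` (LEAD g18; door A2 «additive `2` on E3′ rows» of
# crux 19357 `three_field_road`) — a COROLLARY of the any-two Kronecker engine

Theorems only. `rootNumber_quadraticTwist_eq_of_potMult_nonsplit_pos` (p797679, LEAD g15; the engine of the rank-zero field-one supply
`fieldOneTwistedR0CutOne_of_bfh`) with its binder «`E` not additive at `2`» REPLACED by the sub-row's dyadic twist-type clause, now DERIVED in a few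
lines from the any-two Kronecker engine (`rootNumber_quadraticTwist_eq_of_potMult_kronecker_anyTwo`, p816093): for `D = ℓ₀* m > 0`, `D ≡ 1 (mod 8)`,
`(D/r) = 1` at every odd bad prime `r ≠ ℓ₀`, the Kronecker factors are `χ₈(D) = 1` and `(D/r) = 1`, and `χ₄(|D|) = χ₄(D) = 1`, so `w(E^{(D)}) = w(E)`.

* `rootNumber_quadraticTwist_eq_of_potMult_nonsplit_pos_anyTwo`.

BSD is proved for no curve. [AtkinLi1978] §3; [Rohrlich1993Compositio] Prop. 2–3.
-/

set_option linter.dupNamespace false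
set_option autoImplicit false

noncomputable section

open scoped MatrixGroups Classical

open CongruenceSubgroup Literature.NumberTheory.EllipticCurves Literature.NumberTheory.EllipticCurves.ModularForms
  IsDedekindDomain IsDedekindDomain.HeightOneSpectrum NumberField Rat.HeightOneSpectrum WeierstrassCurve
  Summit.BirchSwinnertonDyer.Rank1Residual Summit.BirchSwinnertonDyer.BirchSwinnertonDyer.Theorems NumberTheorySymbols

namespace Summit.BirchSwinnertonDyer.BirchSwinnertonDyer.Theorems.TwistRootNumberTwisted

variable (W : WeierstrassCurve ℚ) [W.IsElliptic] [W.IsGloballyMinimal]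

/-- **The positive-parameter E3′ engine for any twist-type reduction at `2`**: same hypotheses as
`rootNumber_quadraticTwist_eq_of_potMult_nonsplit_pos` with «`E` not additive at `2`» replaced by the dyadic twist-type clause; conclusion
`w(E^{(D)}) = w(E)`. [cite: AtkinLi1978, §1 and §3] [cite: Rohrlich1993Compositio, Prop. 2 (ii)–(iii) and Prop. 3] [cite: SilvermanAEC2009, X.5 Cor. 5.4 and Ex. 10.16] -/
theorem rootNumber_quadraticTwist_eq_of_potMult_nonsplit_pos_anyTwo (hmod : exists_isNewformOf)
    (htt : ∀ p : Nat.Primes, (p : ℕ) ≠ 2 → W.HasAdditiveReductionAt ((primesEquiv (R := ℤ)).symm p) →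
      ¬ (W.quadraticTwist (((-1 : ℤ) ^ ((p : ℕ) / 2) * p : ℤ) : ℚ)).HasAdditiveReductionAt
        ((primesEquiv (R := ℤ)).symm p))
    (h2tt : ∀ r : Nat.Primes, (r : ℕ) = 2 → W.HasAdditiveReductionAt ((primesEquiv (R := ℤ)).symm r) →
      ∃ t : ℤ, (t = -1 ∨ t = 2 ∨ t = -2) ∧ ¬ (W.quadraticTwist (t : ℚ)).HasAdditiveReductionAt ((primesEquiv (R := ℤ)).symm r))
    {ℓ₀ : ℕ} [hℓ₀ : Fact ℓ₀.Prime] (hℓ₀2 : ℓ₀ ≠ 2)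
    (hadd₀ : W.HasAdditiveReductionAt ((primesEquiv (R := ℤ)).symm ⟨ℓ₀, hℓ₀.out⟩))
    (hmult₀ : (W.quadraticTwist (((-1 : ℤ) ^ (ℓ₀ / 2) * ℓ₀ : ℤ) : ℚ)).HasMultiplicativeReductionAtPrime ℓ₀)
    {D m : ℤ} (hDm : D = (-1 : ℤ) ^ (ℓ₀ / 2) * ℓ₀ * m) (h8 : D % 8 = 1) (hDpos : 0 < D) (hmsq : Squarefree m)
    (hℓ₀m : ¬ (ℓ₀ : ℤ) ∣ m) (hgood : ∀ r : Nat.Primes, ((r : ℕ) : ℤ) ∣ m → W.HasGoodReductionAt ((primesEquiv (R := ℤ)).symm r))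
    (hjac : ∀ p : ℕ, p.Prime → p ∣ W.conductorNorm ℤ → p ≠ 2 → p ≠ ℓ₀ → jacobiSym D p = 1)
    (hnsD : ¬ (W.quadraticTwist (D : ℚ)).HasSplitMultiplicativeReductionAtPrime ℓ₀) :
    (W.quadraticTwist (D : ℚ)).rootNumber = W.rootNumber := by
  have hD4 : D % 4 = 1 := by omega
  have h := rootNumber_quadraticTwist_eq_of_potMult_kronecker_anyTwo W hmod htt h2tt hℓ₀2 hadd₀ hmult₀ hDm hD4 hmsq hℓ₀m hgood hnsD
  -- `χ₄(|D|) = 1`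
  have hχ₄ : ZMod.χ₄ (D.natAbs : ZMod 4) = 1 := by
    obtain ⟨n, hn⟩ := Int.eq_ofNat_of_zero_le hDpos.le
    have hn4 : n % 4 = 1 := by omega
    rw [hn, Int.natAbs_natCast]
    exact ZMod.χ₄_nat_one_mod_four hn4
  -- every Kronecker factor is `1`
  have hprod : (∏ r ∈ (W.conductorNorm ℤ).primeFactors.erase ℓ₀,
      (if (W.conductorNorm ℤ).factorization r = 1 then (if r = 2 then ZMod.χ₈ (D : ZMod 8) else jacobiSym D r) else 1)) = 1 := by
    refine Finset.prod_eq_one fun r hr ↦ ?_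
    obtain ⟨hrℓ, hrN⟩ := Finset.mem_erase.mp hr
    obtain ⟨hrp, hrdvd, -⟩ := Nat.mem_primeFactors.mp hrN
    by_cases h1 : (W.conductorNorm ℤ).factorization r = 1
    · rw [if_pos h1]
      by_cases hr2 : r = 2
      · rw [if_pos hr2, ZMod.χ₈_int_eq_if_mod_eight]
        simp only [show D % 2 ≠ 0 by omega, if_false, h8, true_or, if_true]
      · rw [if_neg hr2]; exact hjac r hrp hrdvd hr2 hrℓ
    · rw [if_neg h1]
  rw [h, hχ₄, hprod]; ring

end Summit.BirchSwinnertonDyer.BirchSwinnertonDyer.Theorems.TwistRootNumberTwisted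

end
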